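import Mathlib

/-!
# Weighted Plancherel (lattice f-sum, bond form) for the block characters of route `BlockLatticeFSum`
(decomp-a2c lens-6 g22; Mathlib only, no definitions, no `sorry`).

For `m : (Fin 3 → Fin K) → ℂ`, `χ_q(B) = exp(2πi Σ_i q_i B_i / K)` and the bond weight
`w_j(q) = 1 − cos(2π q_j / K)`:

  `Σ_q w_j(q) ‖Σ_B conj(χ_q(B)) m_B‖² = (K³/2) · Σ_B ‖m_B − m_{B + e_j}‖²`   (`B + e_j` mod `K`),

hence `Σ_q ε(q) ‖Σ_B conj(χ_q(B)) m_B‖² = (K³/2) Σ_j Σ_B ‖m_B − m_{B+e_j}‖²` with `ε = Σ_j w_j`.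
-/

namespace Summit.AtomisticToContinuum.BoseEinsteinCondensation.Theses.BlockLatticeFSum.WeightedPlancherel

open scoped BigOperators ComplexConjugate

/-- Roots of unity: `Σ_(t<K) exp(2πi t r/K) = K·[K ∣ r]` for `r ∈ ℤ`. -/
theorem sum_exp_eq_dvd {K : ℕ} (hK : 0 < K) (r : ℤ) :
    ∑ t : Fin K, Complex.exp (((2 * Real.pi * ((t : ℕ) : ℝ) * (r : ℝ) / (K : ℝ) : ℝ) : ℂ) * Complex.I)
      = if (K : ℤ) ∣ r then (K : ℂ) else 0 := by
  have hKr : (K : ℝ) ≠ 0 := by exact_mod_cast hK.ne'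
  have hKc : (K : ℂ) ≠ 0 := by exact_mod_cast hK.ne'
  split_ifs with h
  · obtain ⟨c, hc⟩ := h
    have hterm : ∀ t : Fin K, Complex.exp (((2 * Real.pi * ((t : ℕ) : ℝ) * (r : ℝ) / (K : ℝ) : ℝ) : ℂ)
        * Complex.I) = 1 := by
      intro t
      have : (((2 * Real.pi * ((t : ℕ) : ℝ) * (r : ℝ) / (K : ℝ) : ℝ) : ℂ)) * Complex.I
          = (((t : ℕ) : ℤ) * c : ℤ) * (2 * Real.pi * Complex.I) := by
        rw [hc]; push_cast; field_simp
      rw [this]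
      exact Complex.exp_int_mul_two_pi_mul_I _
    rw [Finset.sum_congr rfl fun t _ => hterm t]
    simp
  · set z : ℂ := Complex.exp (((2 * Real.pi * (r : ℝ) / (K : ℝ) : ℝ) : ℂ) * Complex.I) with hz
    have hterm : ∀ t : ℕ, Complex.exp (((2 * Real.pi * (t : ℝ) * (r : ℝ) / (K : ℝ) : ℝ) : ℂ) * Complex.I)
        = z ^ t := by
      intro t
      rw [hz, ← Complex.exp_nat_mul]
      congr 1
      push_cast
      ring
    rw [Fin.sum_univ_eq_sum_range (fun t => Complex.exp (((2 * Real.pi * (t : ℝ) * (r : ℝ) / (K : ℝ) : ℝ) : ℂ) * Complex.I)) K]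
    simp_rw [hterm]
    have hz1 : z ≠ 1 := by
      intro h1
      rw [hz, Complex.exp_eq_one_iff] at h1
      obtain ⟨m, hm⟩ := h1
      have hm' : (((2 * Real.pi * (r : ℝ) / (K : ℝ) : ℝ) : ℂ)) * Complex.I
          = (((m : ℝ) * (2 * Real.pi) : ℝ) : ℂ) * Complex.I := by
        rw [hm]; push_cast; ring
      have hreal : 2 * Real.pi * (r : ℝ) / (K : ℝ) = (m : ℝ) * (2 * Real.pi) :=
        Complex.ofReal_injective (mul_right_cancel₀ Complex.I_ne_zero hm')
      have hrm : (r : ℝ) = (m : ℝ) * (K : ℝ) := by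
        field_simp at hreal
        nlinarith [Real.pi_pos]
      have hrmZ : r = m * K := by exact_mod_cast hrm
      exact h ⟨m, by rw [hrmZ, mul_comm]⟩
    have hzK : z ^ K = 1 := by
      rw [hz, ← Complex.exp_nat_mul]
      have : ((K : ℕ) : ℂ) * ((((2 * Real.pi * (r : ℝ) / (K : ℝ) : ℝ) : ℂ)) * Complex.I)
          = (r : ℂ) * (2 * Real.pi * Complex.I) := by
        have hKc : (K : ℂ) ≠ 0 := by exact_mod_cast hK.ne'
        push_cast
        field_simp
      rw [this]
      exact_mod_cast Complex.exp_int_mul_two_pi_mul_I r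
    rw [geom_sum_eq hz1, hzK, sub_self, zero_div]

/-- For block indices: `K ∣ (a − b + s)` with `a b < K`, `s ∈ {0, 1, −1}` characterised in `Fin K`. -/
theorem dvd_sub_iff_eq {K : ℕ} (a b : Fin K) : ((K : ℤ) ∣ ((a : ℕ) : ℤ) - ((b : ℕ) : ℤ)) ↔ a = b := by
  constructor
  · intro h
    have h1 := a.isLt
    have h2 := b.isLt
    rcases h with ⟨c, hc⟩
    have hc0 : c = 0 := by
      rcases lt_trichotomy c 0 with hc' | hc' | hc'
      · nlinarith
      · exact hc'
      · nlinarith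
    subst hc0
    exact Fin.ext (by omega)
  · rintro rfl
    simp

/-- `K ∣ a − b + 1 ↔ b = (a + 1) mod K` for `a b : Fin K`. [folklore] -/
theorem dvd_sub_add_one_iff {K : ℕ} (a b : Fin K) :
    ((K : ℤ) ∣ ((a : ℕ) : ℤ) - ((b : ℕ) : ℤ) + 1) ↔ (b : ℕ) = ((a : ℕ) + 1) % K := by
  have h1 := a.isLt
  have h2 := b.isLt
  constructor
  · rintro ⟨c, hc⟩
    have hc01 : c = 0 ∨ c = 1 := by
      rcases lt_trichotomy c 0 with hc' | hc' | hc'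
      · nlinarith
      · exact Or.inl hc'
      · rcases lt_or_eq_of_le (show (1 : ℤ) ≤ c from hc') with hc'' | hc''
        · nlinarith
        · exact Or.inr hc''.symm
    rcases hc01 with rfl | rfl
    · have : (b : ℕ) = a + 1 := by omega
      rw [this, Nat.mod_eq_of_lt (by omega)]
    · have : (a : ℕ) + 1 = K + b := by omega
      rw [this, Nat.add_mod_left, Nat.mod_eq_of_lt h2]
  · intro h
    by_cases hlt : (a : ℕ) + 1 < K
    · rw [Nat.mod_eq_of_lt hlt] at h
      exact ⟨0, by omega⟩
    · have hK' : (a : ℕ) + 1 = K := by omega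
      rw [hK', Nat.mod_self] at h
      exact ⟨1, by omega⟩

/-- `cos` of a real number as a combination of two unimodular exponentials. -/
theorem cos_coe (x : ℝ) :
    ((Real.cos x : ℝ) : ℂ) = (Complex.exp ((x : ℂ) * Complex.I) + Complex.exp (-(x : ℂ) * Complex.I)) / 2 := by
  rw [Complex.ofReal_cos, ← Complex.two_cos]
  ring

/-- 3D roots of unity: `Σ_q Π_i exp(2πi q_i r_i/K) = Π_i K·[K ∣ r_i]`. -/
theorem sum_prod_exp {K : ℕ} (hK : 0 < K) (r : Fin 3 → ℤ) :
    ∑ q : Fin 3 → Fin K, ∏ i : Fin 3,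
        Complex.exp (((2 * Real.pi * ((q i : ℕ) : ℝ) * ((r i : ℤ) : ℝ) / (K : ℝ) : ℝ) : ℂ) * Complex.I)
      = if (∀ i : Fin 3, (K : ℤ) ∣ r i) then ((K : ℂ)) ^ 3 else 0 := by
  classical
  rw [← Fintype.prod_sum (fun (i : Fin 3) (t : Fin K) =>
        Complex.exp (((2 * Real.pi * ((t : ℕ) : ℝ) * ((r i : ℤ) : ℝ) / (K : ℝ) : ℝ) : ℂ) * Complex.I))]
  rw [Finset.prod_congr rfl fun i _ => sum_exp_eq_dvd hK (r i)]
  split_ifs with h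
  · rw [Finset.prod_congr rfl fun i _ => if_pos (h i)]
    simp
  · obtain ⟨i, hi⟩ : ∃ i, ¬ (K : ℤ) ∣ r i := by
      by_contra hcon
      exact h fun i => by by_contra hi; exact hcon ⟨i, hi⟩
    exact Finset.prod_eq_zero (Finset.mem_univ i) (if_neg hi)

/-- Product (character) form of `χ_q(B) · conj χ_q(B') · Π_i exp(2πi q_i s_i/K)`. -/
theorem chi_conj_chi_mul_prod {K : ℕ} (q B B' : Fin 3 → Fin K) (s : Fin 3 → ℤ) :
    Complex.exp (((2 * Real.pi * (∑ i : Fin 3, ((q i : ℕ) : ℝ) * ((B i : ℕ) : ℝ)) / (K : ℝ) : ℝ) : ℂ) * Complex.I)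
      * conj (Complex.exp (((2 * Real.pi * (∑ i : Fin 3, ((q i : ℕ) : ℝ) * ((B' i : ℕ) : ℝ)) / (K : ℝ) : ℝ) : ℂ) * Complex.I))
      * ∏ i : Fin 3, Complex.exp (((2 * Real.pi * ((q i : ℕ) : ℝ) * ((s i : ℤ) : ℝ) / (K : ℝ) : ℝ) : ℂ) * Complex.I)
    = ∏ i : Fin 3, Complex.exp (((2 * Real.pi * ((q i : ℕ) : ℝ) *
        (((((B i : ℕ) : ℤ) - ((B' i : ℕ) : ℤ) + s i : ℤ) : ℝ)) / (K : ℝ) : ℝ) : ℂ) * Complex.I) := by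
  rw [← Complex.exp_conj, map_mul, Complex.conj_ofReal, Complex.conj_I, ← Complex.exp_add,
    ← Complex.exp_sum, ← Complex.exp_add, ← Complex.exp_sum]
  congr 1
  push_cast
  rw [Finset.mul_sum, Finset.mul_sum, Finset.sum_div, Finset.sum_div, Finset.sum_mul, Finset.sum_mul,
    ← Finset.sum_add_distrib, ← Finset.sum_add_distrib]
  refine Finset.sum_congr rfl fun i _ => ?_
  ring

/-- The unimodular factor `exp(± 2πi q_j/K)` as a product over the axes. -/
theorem exp_axis_eq_prod {K : ℕ} (q : Fin 3 → Fin K) (j : Fin 3) (σ : ℤ) :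
    Complex.exp ((((σ : ℝ) * (2 * Real.pi * ((q j : ℕ) : ℝ) / (K : ℝ)) : ℝ) : ℂ) * Complex.I)
      = ∏ i : Fin 3, Complex.exp (((2 * Real.pi * ((q i : ℕ) : ℝ) *
          (((Pi.single j σ : Fin 3 → ℤ) i : ℤ) : ℝ) / (K : ℝ) : ℝ) : ℂ) * Complex.I) := by
  classical
  rw [Finset.prod_eq_single j]
  · congr 1
    simp only [Pi.single_eq_same]
    push_cast
    ring
  · intro i _ hi
    rw [Pi.single_eq_of_ne hi]
    simp
  · intro h
    exact absurd (Finset.mem_univ j) h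

/-- INNER SUM of the weighted Plancherel: `Σ_q w_j(q) χ_q(B) conj χ_q(B')`. -/
theorem sum_weight_chi_conj_chi {K : ℕ} (hK : 0 < K) (j : Fin 3) (B B' : Fin 3 → Fin K) :
    ∑ q : Fin 3 → Fin K, (((1 - Real.cos (2 * Real.pi * ((q j : ℕ) : ℝ) / (K : ℝ))) : ℝ) : ℂ) *
      (Complex.exp (((2 * Real.pi * (∑ i : Fin 3, ((q i : ℕ) : ℝ) * ((B i : ℕ) : ℝ)) / (K : ℝ) : ℝ) : ℂ) * Complex.I)
        * conj (Complex.exp (((2 * Real.pi * (∑ i : Fin 3, ((q i : ℕ) : ℝ) * ((B' i : ℕ) : ℝ)) / (K : ℝ) : ℝ) : ℂ) * Complex.I)))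
    = ((K : ℂ)) ^ 3 * ((if (∀ i : Fin 3, (K : ℤ) ∣ ((B i : ℕ) : ℤ) - ((B' i : ℕ) : ℤ)) then 1 else 0)
        - (if (∀ i : Fin 3, (K : ℤ) ∣ ((B i : ℕ) : ℤ) - ((B' i : ℕ) : ℤ) + (Pi.single j (1 : ℤ) : Fin 3 → ℤ) i) then 1 else 0) / 2
        - (if (∀ i : Fin 3, (K : ℤ) ∣ ((B i : ℕ) : ℤ) - ((B' i : ℕ) : ℤ) + (Pi.single j (-1 : ℤ) : Fin 3 → ℤ) i) then 1 else 0) / 2) := by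
  classical
  -- rewrite the weight as 1 - (E₊ + E₋)/2 and distribute
  have hw : ∀ q : Fin 3 → Fin K, (((1 - Real.cos (2 * Real.pi * ((q j : ℕ) : ℝ) / (K : ℝ))) : ℝ) : ℂ)
      = 1 - (∏ i : Fin 3, Complex.exp (((2 * Real.pi * ((q i : ℕ) : ℝ) *
          (((Pi.single j (1 : ℤ) : Fin 3 → ℤ) i : ℤ) : ℝ) / (K : ℝ) : ℝ) : ℂ) * Complex.I)
        + ∏ i : Fin 3, Complex.exp (((2 * Real.pi * ((q i : ℕ) : ℝ) *
          (((Pi.single j (-1 : ℤ) : Fin 3 → ℤ) i : ℤ) : ℝ) / (K : ℝ) : ℝ) : ℂ) * Complex.I)) / 2 := by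
    intro q
    rw [← exp_axis_eq_prod q j 1, ← exp_axis_eq_prod q j (-1), Complex.ofReal_sub, Complex.ofReal_one,
      cos_coe]
    congr 3
    · push_cast; ring_nf
    · push_cast; ring_nf
  have h0 : ∀ q : Fin 3 → Fin K,
      Complex.exp (((2 * Real.pi * (∑ i : Fin 3, ((q i : ℕ) : ℝ) * ((B i : ℕ) : ℝ)) / (K : ℝ) : ℝ) : ℂ) * Complex.I)
        * conj (Complex.exp (((2 * Real.pi * (∑ i : Fin 3, ((q i : ℕ) : ℝ) * ((B' i : ℕ) : ℝ)) / (K : ℝ) : ℝ) : ℂ) * Complex.I))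
      = ∏ i : Fin 3, Complex.exp (((2 * Real.pi * ((q i : ℕ) : ℝ) *
        (((((B i : ℕ) : ℤ) - ((B' i : ℕ) : ℤ) + (0 : Fin 3 → ℤ) i : ℤ) : ℝ)) / (K : ℝ) : ℝ) : ℂ) * Complex.I) := by
    intro q
    rw [← chi_conj_chi_mul_prod q B B' 0]
    simp
  calc _ = ∑ q : Fin 3 → Fin K,
        ((∏ i : Fin 3, Complex.exp (((2 * Real.pi * ((q i : ℕ) : ℝ) *
          (((((B i : ℕ) : ℤ) - ((B' i : ℕ) : ℤ) + (0 : Fin 3 → ℤ) i : ℤ) : ℝ)) / (K : ℝ) : ℝ) : ℂ) * Complex.I))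
        - (∏ i : Fin 3, Complex.exp (((2 * Real.pi * ((q i : ℕ) : ℝ) *
          (((((B i : ℕ) : ℤ) - ((B' i : ℕ) : ℤ) + (Pi.single j (1 : ℤ) : Fin 3 → ℤ) i : ℤ) : ℝ)) / (K : ℝ) : ℝ) : ℂ) * Complex.I)) / 2
        - (∏ i : Fin 3, Complex.exp (((2 * Real.pi * ((q i : ℕ) : ℝ) *
          (((((B i : ℕ) : ℤ) - ((B' i : ℕ) : ℤ) + (Pi.single j (-1 : ℤ) : Fin 3 → ℤ) i : ℤ) : ℝ)) / (K : ℝ) : ℝ) : ℂ) * Complex.I)) / 2) := by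
          refine Finset.sum_congr rfl fun q _ => ?_
          rw [hw q, ← chi_conj_chi_mul_prod q B B' (Pi.single j (1 : ℤ)),
            ← chi_conj_chi_mul_prod q B B' (Pi.single j (-1 : ℤ)), h0 q, ← chi_conj_chi_mul_prod q B B' 0]
          simp only [Pi.zero_apply, Int.cast_zero, mul_zero, zero_div, Complex.ofReal_zero, zero_mul,
            Complex.exp_zero, Finset.prod_const_one, mul_one]
          ring
    _ = _ := by
          rw [Finset.sum_sub_distrib, Finset.sum_sub_distrib, ← Finset.sum_div, ← Finset.sum_div,
            sum_prod_exp hK, sum_prod_exp hK, sum_prod_exp hK]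
          simp only [Pi.zero_apply, add_zero]
          split_ifs <;> ring

/-- Double sums against Kronecker deltas. -/
theorem dsum_diag {ι : Type*} [Fintype ι] [DecidableEq ι] (g : ι → ι → ℂ) :
    ∑ B : ι, ∑ B' : ι, (if B = B' then g B B' else 0) = ∑ B : ι, g B B := by
  refine Finset.sum_congr rfl fun B _ => ?_
  rw [Finset.sum_ite_eq]
  simp

/-- A double sum supported on the graph `B' = σ B` collapses to a single sum. [folklore] -/
theorem dsum_graph {ι : Type*} [Fintype ι] [DecidableEq ι] (σ : ι → ι) (g : ι → ι → ℂ) :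
    ∑ B : ι, ∑ B' : ι, (if B' = σ B then g B B' else 0) = ∑ B : ι, g B (σ B) := by
  refine Finset.sum_congr rfl fun B _ => ?_
  rw [Finset.sum_ite_eq']
  simp

/-- A double sum supported on the graph `B = σ B'` collapses to a single sum. [folklore] -/
theorem dsum_graph' {ι : Type*} [Fintype ι] [DecidableEq ι] (σ : ι → ι) (g : ι → ι → ℂ) :
    ∑ B : ι, ∑ B' : ι, (if B = σ B' then g B B' else 0) = ∑ B' : ι, g (σ B') B' := by
  rw [Finset.sum_comm]
  refine Finset.sum_congr rfl fun B' _ => ?_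
  rw [Finset.sum_ite_eq']
  simp

/-- Successor maps along an axis are injective (hence bijective). -/
theorem succ_injective {K : ℕ} (j : Fin 3) (σ : (Fin 3 → Fin K) → (Fin 3 → Fin K))
    (hσ : ∀ B : Fin 3 → Fin K, (∀ i : Fin 3, i ≠ j → σ B i = B i) ∧ ((σ B j : ℕ) = ((B j : ℕ) + 1) % K)) :
    Function.Injective σ := by
  intro B B' h
  funext i
  by_cases hij : i = j
  · subst hij
    have h1 := (hσ B).2
    have h2 := (hσ B').2
    rw [h, h2] at h1
    have ha := (B i).isLt
    have hb := (B' i).isLt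
    apply Fin.ext
    by_cases hA : (B i : ℕ) + 1 < K <;> by_cases hB : (B' i : ℕ) + 1 < K
    · rw [Nat.mod_eq_of_lt hA, Nat.mod_eq_of_lt hB] at h1; omega
    · rw [Nat.mod_eq_of_lt hA, show (B' i : ℕ) + 1 = K by omega, Nat.mod_self] at h1; omega
    · rw [Nat.mod_eq_of_lt hB, show (B i : ℕ) + 1 = K by omega, Nat.mod_self] at h1; omega
    · omega
  · rw [← (hσ B).1 i hij, ← (hσ B').1 i hij, h]

/-- **WEIGHTED PLANCHEREL** (lattice f-sum rule in bond form, one axis `j`): for ANY successor map `σ`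
along `j` (spec `hσ`; e.g. `σ B i = if i = j then ⟨(B i + 1) % K, _⟩ else B i`),
`Σ_q (1 − cos(2π q_j/K)) ‖Σ_B conj(χ_q(B)) m_B‖² = (K³/2) Σ_B ‖m_B − m_(σ B)‖²`. -/
theorem weighted_plancherel {K : ℕ} (hK : 0 < K) (j : Fin 3)
    (σ : (Fin 3 → Fin K) → (Fin 3 → Fin K))
    (hσ : ∀ B : Fin 3 → Fin K, (∀ i : Fin 3, i ≠ j → σ B i = B i) ∧ ((σ B j : ℕ) = ((B j : ℕ) + 1) % K))
    (m : (Fin 3 → Fin K) → ℂ) :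
    ∑ q : Fin 3 → Fin K, (1 - Real.cos (2 * Real.pi * ((q j : ℕ) : ℝ) / (K : ℝ))) *
        ‖∑ B : Fin 3 → Fin K, conj (Complex.exp (((2 * Real.pi * (∑ i : Fin 3, ((q i : ℕ) : ℝ) * ((B i : ℕ) : ℝ)) / (K : ℝ) : ℝ) : ℂ) * Complex.I)) * m B‖ ^ 2
      = (K : ℝ) ^ 3 / 2 * ∑ B : Fin 3 → Fin K, ‖m B - m (σ B)‖ ^ 2 := by
  classical
  -- index characterisations of the three Kronecker conditions
  have hc0 : ∀ B B' : Fin 3 → Fin K,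
      (∀ i : Fin 3, (K : ℤ) ∣ ((B i : ℕ) : ℤ) - ((B' i : ℕ) : ℤ)) ↔ B = B' := fun B B' =>
    ⟨fun h => funext fun i => (dvd_sub_iff_eq _ _).1 (h i), fun h i => by subst h; simp⟩
  have hc1 : ∀ B B' : Fin 3 → Fin K,
      (∀ i : Fin 3, (K : ℤ) ∣ ((B i : ℕ) : ℤ) - ((B' i : ℕ) : ℤ) + (Pi.single j (1 : ℤ) : Fin 3 → ℤ) i)
        ↔ B' = σ B := by
    intro B B'
    constructor
    · intro h
      funext i
      by_cases hij : i = j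
      · subst hij
        have hi := h i
        rw [Pi.single_eq_same, dvd_sub_add_one_iff] at hi
        exact Fin.ext (by rw [hi, (hσ B).2])
      · have hi := h i
        rw [Pi.single_eq_of_ne hij, add_zero] at hi
        rw [(hσ B).1 i hij]
        exact ((dvd_sub_iff_eq _ _).1 hi).symm
    · rintro rfl i
      by_cases hij : i = j
      · subst hij
        rw [Pi.single_eq_same, dvd_sub_add_one_iff]
        exact (hσ B).2
      · rw [Pi.single_eq_of_ne hij, add_zero, (hσ B).1 i hij]
        simp
  have hc2 : ∀ B B' : Fin 3 → Fin K,
      (∀ i : Fin 3, (K : ℤ) ∣ ((B i : ℕ) : ℤ) - ((B' i : ℕ) : ℤ) + (Pi.single j (-1 : ℤ) : Fin 3 → ℤ) i)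
        ↔ B = σ B' := by
    intro B B'
    have key : ∀ i : Fin 3,
        ((K : ℤ) ∣ ((B i : ℕ) : ℤ) - ((B' i : ℕ) : ℤ) + (Pi.single j (-1 : ℤ) : Fin 3 → ℤ) i)
          ↔ ((K : ℤ) ∣ ((B' i : ℕ) : ℤ) - ((B i : ℕ) : ℤ) + (Pi.single j (1 : ℤ) : Fin 3 → ℤ) i) := by
      intro i
      have hneg : -(((B i : ℕ) : ℤ) - ((B' i : ℕ) : ℤ) + (Pi.single j (-1 : ℤ) : Fin 3 → ℤ) i)
          = ((B' i : ℕ) : ℤ) - ((B i : ℕ) : ℤ) + (Pi.single j (1 : ℤ) : Fin 3 → ℤ) i := by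
        by_cases hij : i = j
        · subst hij; simp; ring
        · simp [Pi.single_eq_of_ne hij]
      rw [← dvd_neg, hneg]
    rw [forall_congr' key]
    exact hc1 B' B
  have hσbij : Function.Bijective σ := Finite.injective_iff_bijective.1 (succ_injective j σ hσ)
  -- the complex identity
  have hsq : ∀ z : ℂ, ((‖z‖ : ℂ)) ^ 2 = conj z * z := fun z => (Complex.conj_mul' z).symm
  have main : ∑ q : Fin 3 → Fin K, (((1 - Real.cos (2 * Real.pi * ((q j : ℕ) : ℝ) / (K : ℝ))) : ℝ) : ℂ) * (conj (∑ B : Fin 3 → Fin K, conj (Complex.exp (((2 * Real.pi * (∑ i : Fin 3, ((q i : ℕ) : ℝ) * ((B i : ℕ) : ℝ)) / (K : ℝ) : ℝ) : ℂ) * Complex.I)) * m B)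
        * (∑ B : Fin 3 → Fin K, conj (Complex.exp (((2 * Real.pi * (∑ i : Fin 3, ((q i : ℕ) : ℝ) * ((B i : ℕ) : ℝ)) / (K : ℝ) : ℝ) : ℂ) * Complex.I)) * m B))
      = ((K : ℂ)) ^ 3 / 2 * ∑ B : Fin 3 → Fin K, conj (m B - m (σ B)) * (m B - m (σ B)) := by
    calc ∑ q : Fin 3 → Fin K, (((1 - Real.cos (2 * Real.pi * ((q j : ℕ) : ℝ) / (K : ℝ))) : ℝ) : ℂ) * (conj (∑ B : Fin 3 → Fin K, conj (Complex.exp (((2 * Real.pi * (∑ i : Fin 3, ((q i : ℕ) : ℝ) * ((B i : ℕ) : ℝ)) / (K : ℝ) : ℝ) : ℂ) * Complex.I)) * m B)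
          * (∑ B : Fin 3 → Fin K, conj (Complex.exp (((2 * Real.pi * (∑ i : Fin 3, ((q i : ℕ) : ℝ) * ((B i : ℕ) : ℝ)) / (K : ℝ) : ℝ) : ℂ) * Complex.I)) * m B))
        = ∑ q : Fin 3 → Fin K, ∑ B : Fin 3 → Fin K, ∑ B' : Fin 3 → Fin K,
            conj (m B) * m B' * ((((1 - Real.cos (2 * Real.pi * ((q j : ℕ) : ℝ) / (K : ℝ))) : ℝ) : ℂ) * (Complex.exp (((2 * Real.pi * (∑ i : Fin 3, ((q i : ℕ) : ℝ) * ((B i : ℕ) : ℝ)) / (K : ℝ) : ℝ) : ℂ) * Complex.I) * conj (Complex.exp (((2 * Real.pi * (∑ i : Fin 3, ((q i : ℕ) : ℝ) * ((B' i : ℕ) : ℝ)) / (K : ℝ) : ℝ) : ℂ) * Complex.I)))) := by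
          refine Finset.sum_congr rfl fun q _ => ?_
          rw [map_sum, Finset.sum_mul, Finset.mul_sum]
          refine Finset.sum_congr rfl fun B _ => ?_
          rw [map_mul, Complex.conj_conj, Finset.mul_sum, Finset.mul_sum]
          refine Finset.sum_congr rfl fun B' _ => ?_
          ring
      _ = ∑ B : Fin 3 → Fin K, ∑ B' : Fin 3 → Fin K, conj (m B) * m B' *
            ∑ q : Fin 3 → Fin K, (((1 - Real.cos (2 * Real.pi * ((q j : ℕ) : ℝ) / (K : ℝ))) : ℝ) : ℂ) * (Complex.exp (((2 * Real.pi * (∑ i : Fin 3, ((q i : ℕ) : ℝ) * ((B i : ℕ) : ℝ)) / (K : ℝ) : ℝ) : ℂ) * Complex.I) * conj (Complex.exp (((2 * Real.pi * (∑ i : Fin 3, ((q i : ℕ) : ℝ) * ((B' i : ℕ) : ℝ)) / (K : ℝ) : ℝ) : ℂ) * Complex.I))) := by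
          rw [Finset.sum_comm]
          refine Finset.sum_congr rfl fun B _ => ?_
          rw [Finset.sum_comm]
          refine Finset.sum_congr rfl fun B' _ => ?_
          rw [Finset.mul_sum]
      _ = ∑ B : Fin 3 → Fin K, ∑ B' : Fin 3 → Fin K, conj (m B) * m B' *
            (((K : ℂ)) ^ 3 * ((if B = B' then 1 else 0) - (if B' = σ B then 1 else 0) / 2
              - (if B = σ B' then 1 else 0) / 2)) := by
          refine Finset.sum_congr rfl fun B _ => Finset.sum_congr rfl fun B' _ => ?_
          rw [sum_weight_chi_conj_chi hK j B B']
          simp only [hc0 B B', hc1 B B', hc2 B B']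
      _ = ((K : ℂ)) ^ 3 * (∑ B : Fin 3 → Fin K, ∑ B' : Fin 3 → Fin K, (if B = B' then conj (m B) * m B' else 0))
          - ((K : ℂ)) ^ 3 / 2 * (∑ B : Fin 3 → Fin K, ∑ B' : Fin 3 → Fin K,
              (if B' = σ B then conj (m B) * m B' else 0))
          - ((K : ℂ)) ^ 3 / 2 * (∑ B : Fin 3 → Fin K, ∑ B' : Fin 3 → Fin K,
              (if B = σ B' then conj (m B) * m B' else 0)) := by
          rw [Finset.mul_sum, Finset.mul_sum, Finset.mul_sum, ← Finset.sum_sub_distrib,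
            ← Finset.sum_sub_distrib]
          refine Finset.sum_congr rfl fun B _ => ?_
          rw [Finset.mul_sum, Finset.mul_sum, Finset.mul_sum, ← Finset.sum_sub_distrib,
            ← Finset.sum_sub_distrib]
          refine Finset.sum_congr rfl fun B' _ => ?_
          split_ifs <;> ring
      _ = ((K : ℂ)) ^ 3 * ∑ B : Fin 3 → Fin K, conj (m B) * m B
          - ((K : ℂ)) ^ 3 / 2 * ∑ B : Fin 3 → Fin K, conj (m B) * m (σ B)
          - ((K : ℂ)) ^ 3 / 2 * ∑ B' : Fin 3 → Fin K, conj (m (σ B')) * m B' := by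
          rw [dsum_diag (fun B B' => conj (m B) * m B'), dsum_graph σ (fun B B' => conj (m B) * m B'),
            dsum_graph' σ (fun B B' => conj (m B) * m B')]
      _ = ((K : ℂ)) ^ 3 / 2 * ∑ B : Fin 3 → Fin K, conj (m B - m (σ B)) * (m B - m (σ B)) := by
          have hre : ∑ B : Fin 3 → Fin K, conj (m (σ B)) * m (σ B) = ∑ B : Fin 3 → Fin K, conj (m B) * m B :=
            Equiv.sum_comp (Equiv.ofBijective σ hσbij) (fun B => conj (m B) * m B)
          have hexp : ∑ B : Fin 3 → Fin K, conj (m B - m (σ B)) * (m B - m (σ B))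
              = ∑ B : Fin 3 → Fin K, conj (m B) * m B + ∑ B : Fin 3 → Fin K, conj (m (σ B)) * m (σ B)
                - ∑ B : Fin 3 → Fin K, conj (m B) * m (σ B) - ∑ B : Fin 3 → Fin K, conj (m (σ B)) * m B := by
            rw [← Finset.sum_add_distrib, ← Finset.sum_sub_distrib, ← Finset.sum_sub_distrib]
            refine Finset.sum_congr rfl fun B _ => ?_
            rw [map_sub]
            ring
          rw [hexp, hre]
          ring
  -- back to ℝ
  apply Complex.ofReal_injective
  rw [Complex.ofReal_sum, Complex.ofReal_mul, Complex.ofReal_div, Complex.ofReal_pow, Complex.ofReal_natCast,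
    Complex.ofReal_ofNat, Complex.ofReal_sum]
  simp_rw [Complex.ofReal_mul, Complex.ofReal_pow, hsq]
  exact main

end Summit.AtomisticToContinuum.BoseEinsteinCondensation.Theses.BlockLatticeFSum.WeightedPlancherel
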